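import Literature.MathematicalPhysics.KineticTheory.DiPernaLionsKernelSmoothing
import HarnessLib

/-!
# The line bound for gain terms of grazing-truncated kernels (CIP 1994 (3.19))

Topic: MathematicalPhysics / KineticTheory. Infrastructure for the truncated problems of the
DiPerna–Lions scheme (`truncatedProblem_globalExistence`, CIP 1994 Lemma 5.3.6). The key to the
global (in time) solvability of the truncated equation is the *linear* `L^∞` bound (3.19),
`‖Q̃(g,g)‖_∞ ≤ C₀ ‖g‖_∞`, whose mechanism is: for a kernel vanishing near grazing collisions
(`|⟨z,ω⟩| < δ`) and for large relative velocities, `∫∫ B(v - v_*, ω) g(v') dv_* dω` is bounded by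
`C δ^{1-d} ∫ g` — the post-collisional velocity `v' = v - ⟨z,ω⟩ω` (`z = v - v_*`) only sees the
component of `z` along `ω`, and in polar coordinates along `ω` the Jacobian `|y|^{d-1}` is
`≥ δ^{d-1}` on the support (CIP p. 146). Everything is proved; theorems only, in `∫⁻` form.

* `exists_orthonormalBasis_first_eq`: a unit vector is the first vector of an orthonormal basis.
* `lintegral_mul_comp_inner_le` (slab bound): `∫ B(z) φ(⟨z,ω⟩) dz ≤ M (2R)^{d-1} ∫_{[-R,R]} φ`
  for `0 ≤ B ≤ M` supported in `|z| ≤ R` (orthonormal coordinates adapted to `ω`,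
  `OrthonormalBasis.measurePreserving_repr`, `measurePreserving_piFinSuccAbove`).
* `lintegral_sphere_line_le`: `∫_{S^{d-1}} ∫_{|s| ≥ δ} g(v - sω) ds dσ ≤ 2 δ^{1-d} ∫ g`
  (polar coordinates `lintegral_eq_lintegral_sphereMeasure_radial`, antipodal symmetry).
* `lintegral_kernel_gain_line_le`: the line bound
  `∫_{S^{d-1}} ∫_E b(z,ω) g(v - ⟨z,ω⟩ω) dz dσ ≤ 2 M (2R)^{d-1} δ^{1-d} ∫ g`.

## References

* C. Cercignani, R. Illner, M. Pulvirenti, *The Mathematical Theory of Dilute Gases*, Springer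
  (1994), §5.3 (3.19) and its proof, pp. 145–146.
-/

open MeasureTheory Metric Real Set Filter Topology
open scoped InnerProductSpace ENNReal NNReal

noncomputable section

namespace Literature.MathematicalPhysics.KineticTheory

open Literature.Analysis.FluidPDE

variable {E : Type*} [NormedAddCommGroup E] [InnerProductSpace ℝ E] [FiniteDimensional ℝ E]
  [MeasurableSpace E] [BorelSpace E]

/-! ## An orthonormal basis through a unit vector -/

omit [MeasurableSpace E] [BorelSpace E] in
/-- Every unit vector is the first vector of an orthonormal basis indexed by `Fin (n + 1)`,
`n + 1 = dim E`. [folklore] -/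
theorem exists_orthonormalBasis_first_eq {ω : E} (hω : ‖ω‖ = 1) :
    ∃ (n : ℕ) (b : OrthonormalBasis (Fin (n + 1)) ℝ E), b 0 = ω ∧ n + 1 = Module.finrank ℝ E := by
  classical
  -- extend the orthonormal singleton `{ω}`
  have hon : Orthonormal ℝ ((↑) : ({ω} : Set E) → E) := by
    rw [orthonormal_subtype_iff_ite]
    intro v hv w hw
    rw [mem_singleton_iff] at hv hw
    subst hv; subst hw
    simp only [if_true, real_inner_self_eq_norm_sq, hω, one_pow]
  obtain ⟨u, b, hωu, hb⟩ := hon.exists_orthonormalBasis_extension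
  have hωmem : ω ∈ u := hωu (mem_singleton ω)
  -- reindex by `Fin (card u)` with `ω` at `0`
  have hcard : Fintype.card u = Module.finrank ℝ E := (Module.finrank_eq_card_basis b.toBasis).symm
  have hpos : 0 < Fintype.card u := Fintype.card_pos_iff.2 ⟨⟨ω, hωmem⟩⟩
  obtain ⟨n, hn⟩ : ∃ n, Fintype.card u = n + 1 := ⟨Fintype.card u - 1, by omega⟩
  let e₀ : u ≃ Fin (n + 1) := Fintype.equivFinOfCardEq hn
  let e : u ≃ Fin (n + 1) := e₀.trans (Equiv.swap (e₀ ⟨ω, hωmem⟩) 0)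
  refine ⟨n, b.reindex e, ?_, by rw [← hn, hcard]⟩
  rw [OrthonormalBasis.reindex_apply]
  have he : e.symm 0 = ⟨ω, hωmem⟩ := by
    rw [Equiv.symm_apply_eq]
    simp [e]
  rw [he, hb]

/-! ## The slab bound: Fubini along a fixed direction -/

/-- **The slab bound.** For `B ≥ 0` measurable on `E`, bounded by `M` and vanishing off the ball
of radius `R`, a unit vector `ω` and measurable `φ ≥ 0` on `ℝ`:
`∫ B(z) φ(⟨z, ω⟩) dz ≤ M (2R)^{d-1} ∫_{[-R,R]} φ` (orthonormal coordinates with first axis `ω`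
and Fubini; the transversal section of the ball lies in the cube of side `2R`). [folklore] -/
theorem lintegral_mul_comp_inner_le {ω : E} (hω : ‖ω‖ = 1) {B : E → ℝ≥0∞}
    {M : ℝ≥0∞} (hBM : ∀ z, B z ≤ M) {R : ℝ} (hBsupp : ∀ z, R < ‖z‖ → B z = 0)
    {φ : ℝ → ℝ≥0∞} (hφ : Measurable φ) :
    ∫⁻ z, B z * φ ⟪z, ω⟫_ℝ ≤
      M * ENNReal.ofReal (2 * R) ^ (Module.finrank ℝ E - 1) * ∫⁻ s in Icc (-R) R, φ s := by
  obtain ⟨n, b, hb0, hdim⟩ := exists_orthonormalBasis_first_eq hω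
  have hn : Module.finrank ℝ E - 1 = n := by omega
  rw [hn]
  -- the measure-preserving coordinate map `E → ℝ × (Fin n → ℝ)`
  set Ψ : E → ℝ × (Fin n → ℝ) := fun z =>
    MeasurableEquiv.piFinSuccAbove (fun _ : Fin (n + 1) => ℝ) 0 (WithLp.ofLp (b.repr z)) with hΨ
  have hΨmp : MeasurePreserving Ψ (volume : Measure E) ((volume : Measure ℝ).prod (volume : Measure (Fin n → ℝ))) :=
    ((measurePreserving_piFinSuccAbove (fun _ : Fin (n + 1) => (volume : Measure ℝ)) 0).comp
      (PiLp.volume_preserving_ofLp (Fin (n + 1)))).comp b.measurePreserving_repr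
  have hΨ1 : ∀ z, (Ψ z).1 = ⟪z, ω⟫_ℝ := fun z => by
    simp only [hΨ]
    rw [show (MeasurableEquiv.piFinSuccAbove (fun _ : Fin (n + 1) => ℝ) 0 (WithLp.ofLp (b.repr z))).1 = ⟪b 0, z⟫_ℝ by
      simp [MeasurableEquiv.piFinSuccAbove_apply, OrthonormalBasis.repr_apply_apply], hb0, real_inner_comm]
  have hΨ2 : ∀ z (i : Fin n), (Ψ z).2 i = ⟪b i.succ, z⟫_ℝ := fun z i => by
    simp [hΨ, MeasurableEquiv.piFinSuccAbove_apply, OrthonormalBasis.repr_apply_apply, Fin.tail]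
  have hcoord : ∀ z (i : Fin (n + 1)), |⟪b i, z⟫_ℝ| ≤ ‖z‖ := fun z i => by
    have := abs_real_inner_le_norm (b i) z
    simpa [b.orthonormal.1 i] using this
  -- the dominating product function on `ℝ × (Fin n → ℝ)`
  set box : Set (Fin n → ℝ) := Set.pi univ fun _ => Icc (-R) R with hbox
  have hboxm : MeasurableSet box := MeasurableSet.univ_pi fun _ => measurableSet_Icc
  set G : ℝ × (Fin n → ℝ) → ℝ≥0∞ := fun q => (M * (Icc (-R) R).indicator φ q.1) * box.indicator (fun _ => (1 : ℝ≥0∞)) q.2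
    with hG
  have hGm : Measurable G :=
    ((measurable_const.mul ((hφ.indicator measurableSet_Icc).comp measurable_fst))).mul
      ((measurable_const.indicator hboxm).comp measurable_snd)
  have hdom : ∀ z, B z * φ ⟪z, ω⟫_ℝ ≤ G (Ψ z) := by
    intro z
    by_cases hz : R < ‖z‖
    · rw [hBsupp z hz, zero_mul]; exact bot_le
    · rw [not_lt] at hz
      have hs' : ⟪z, ω⟫_ℝ ∈ Icc (-R) R := by
        rw [real_inner_comm, ← hb0]; exact abs_le.1 ((hcoord z 0).trans hz)
      have hc : (Ψ z).2 ∈ box := by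
        simp only [hbox, Set.mem_pi, mem_univ, true_implies]
        intro i; rw [hΨ2]; exact abs_le.1 ((hcoord z _).trans hz)
      simp only [hG, indicator_of_mem hc, mul_one, hΨ1, indicator_of_mem hs']
      exact mul_le_mul_of_nonneg_right (hBM z) bot_le
  -- integrate
  calc ∫⁻ z, B z * φ ⟪z, ω⟫_ℝ ≤ ∫⁻ z, G (Ψ z) := lintegral_mono hdom
    _ = ∫⁻ q, G q ∂((volume : Measure ℝ).prod (volume : Measure (Fin n → ℝ))) := hΨmp.lintegral_comp hGm
    _ = (∫⁻ s, M * (Icc (-R) R).indicator φ s) * ∫⁻ c : Fin n → ℝ, box.indicator (fun _ => (1 : ℝ≥0∞)) c := by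
        rw [hG]
        exact lintegral_prod_mul ((measurable_const.mul (hφ.indicator measurableSet_Icc))).aemeasurable
          ((measurable_const.indicator hboxm)).aemeasurable
    _ = M * ENNReal.ofReal (2 * R) ^ n * ∫⁻ s in Icc (-R) R, φ s := by
        rw [lintegral_const_mul _ (hφ.indicator measurableSet_Icc), lintegral_indicator measurableSet_Icc,
          lintegral_indicator hboxm, setLIntegral_const, one_mul, hbox, volume_pi_pi]
        simp only [Real.volume_Icc, Finset.prod_const, Finset.card_univ, Fintype.card_fin]
        rw [show R - -R = 2 * R by ring]
        ring

/-! ## The two-sided line integral over all directions -/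

/-- **Lines through `v` in all directions, away from `v`:**
`∫_{S^{d-1}} ∫_{|s| ≥ δ} g(v - sω) ds dσ(ω) ≤ 2 δ^{1-d} ∫_E g` for measurable `g ≥ 0` and `δ > 0`
(polar coordinates: `ds dσ = |y|^{1-d} dy` along `y = sω`, and `|y| ≥ δ`). [folklore] -/
theorem lintegral_sphere_line_le [Nontrivial E] {g : E → ℝ≥0∞} (hg : Measurable g) (v : E) {δ : ℝ}
    (hδ : 0 < δ) :
    ∫⁻ ω, (∫⁻ s in {s : ℝ | δ ≤ |s|}, g (v - s • (ω : E))) ∂(sphereMeasure : Measure (sphere (0 : E) 1)) ≤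
      2 * ENNReal.ofReal ((δ ^ (Module.finrank ℝ E - 1))⁻¹) * ∫⁻ y, g y := by
  haveI := isFiniteMeasure_sphereMeasure (E := E)
  set d : ℕ := Module.finrank ℝ E with hd
  -- one-sided bound along rays: `∫_{s ≥ δ} g(v - sω) ds ≤ δ^{1-d} ∫_{s > 0} s^{d-1} g(v - sω) ds`
  have hray : ∀ ω : sphere (0 : E) 1, ∫⁻ s in Ici δ, g (v - s • (ω : E)) ≤
      ENNReal.ofReal ((δ ^ (d - 1))⁻¹) * ∫⁻ s in Ioi (0 : ℝ), ENNReal.ofReal (s ^ (d - 1)) * g (v - s • (ω : E)) := by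
    intro ω
    rw [← lintegral_const_mul' _ _ ENNReal.ofReal_ne_top]
    calc ∫⁻ s in Ici δ, g (v - s • (ω : E))
        ≤ ∫⁻ s in Ici δ, ENNReal.ofReal ((δ ^ (d - 1))⁻¹) * (ENNReal.ofReal (s ^ (d - 1)) * g (v - s • (ω : E))) := by
          refine setLIntegral_mono' measurableSet_Ici fun s hs => ?_
          have hsδ : δ ≤ s := hs
          have h1 : (1 : ℝ≥0∞) ≤ ENNReal.ofReal ((δ ^ (d - 1))⁻¹) * ENNReal.ofReal (s ^ (d - 1)) := by
            rw [← ENNReal.ofReal_mul (inv_nonneg.2 (pow_nonneg hδ.le _)), ← ENNReal.ofReal_one]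
            refine ENNReal.ofReal_le_ofReal ?_
            rw [inv_mul_eq_div, le_div_iff₀ (pow_pos hδ _), one_mul]
            exact pow_le_pow_left₀ hδ.le hsδ _
          calc g (v - s • (ω : E)) = 1 * g (v - s • (ω : E)) := (one_mul _).symm
            _ ≤ _ := by rw [← mul_assoc]; exact mul_le_mul_of_nonneg_right h1 bot_le
      _ ≤ ∫⁻ s in Ioi (0 : ℝ), ENNReal.ofReal ((δ ^ (d - 1))⁻¹) * (ENNReal.ofReal (s ^ (d - 1)) * g (v - s • (ω : E))) :=
          lintegral_mono_set fun s hs => lt_of_lt_of_le hδ hs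
  -- the two half-lines: `s ≤ -δ` contributes the same as `s ≥ δ` after `ω ↦ -ω`
  have hsplit : ∀ ω : sphere (0 : E) 1, ∫⁻ s in {s : ℝ | δ ≤ |s|}, g (v - s • (ω : E)) =
      (∫⁻ s in Ici δ, g (v - s • (ω : E))) + ∫⁻ s in Ici δ, g (v - s • (((-ω : sphere (0 : E) 1)) : E)) := by
    intro ω
    have hset : {s : ℝ | δ ≤ |s|} = Ici δ ∪ Iic (-δ) := by
      ext s; simp only [mem_setOf_eq, mem_union, mem_Ici, mem_Iic, le_abs, le_neg]
    have hdisj : Disjoint (Ici δ) (Iic (-δ)) := by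
      rw [Set.disjoint_iff]; intro s ⟨h1, h2⟩; simp only [mem_Ici, mem_Iic] at h1 h2; linarith
    rw [hset, lintegral_union measurableSet_Iic hdisj]
    congr 1
    -- `s ↦ -s` on the second piece
    have hneg : ∫⁻ s in Iic (-δ), g (v - s • (ω : E)) = ∫⁻ s in Ici δ, g (v - (-s) • (ω : E)) := by
      have hmp : MeasurePreserving (fun s : ℝ => -s) volume volume := Measure.measurePreserving_neg volume
      set f : ℝ → ℝ≥0∞ := (Iic (-δ)).indicator fun s => g (v - s • (ω : E)) with hf
      have hfm : Measurable f :=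
        (hg.comp (measurable_const.sub (measurable_id.smul measurable_const))).indicator measurableSet_Iic
      rw [← lintegral_indicator measurableSet_Iic, ← lintegral_indicator measurableSet_Ici]
      rw [show (∫⁻ s, (Iic (-δ)).indicator (fun s => g (v - s • (ω : E))) s) = ∫⁻ s, f s from rfl,
        ← hmp.lintegral_comp hfm]
      refine lintegral_congr fun s => ?_
      simp only [hf, indicator, mem_Iic, mem_Ici, neg_le_neg_iff]
    rw [hneg]
    refine lintegral_congr fun s => ?_
    simp only [coe_neg_sphere, smul_neg, neg_smul]
  -- integrate over the sphere
  have hm : Measurable fun q : sphere (0 : E) 1 × ℝ => g (v - q.2 • (q.1 : E)) :=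
    hg.comp (measurable_const.sub (measurable_snd.smul (measurable_subtype_coe.comp measurable_fst)))
  have hmeas1 : Measurable fun ω : sphere (0 : E) 1 => ∫⁻ s in Ici δ, g (v - s • (ω : E)) := by
    have : Measurable fun ω : sphere (0 : E) 1 => ∫⁻ s, (Ici δ).indicator (fun s => g (v - s • (ω : E))) s := by
      refine Measurable.lintegral_prod_right ?_
      exact (hm.indicator (measurableSet_Ici.preimage measurable_snd) : Measurable fun q : sphere (0 : E) 1 × ℝ =>
        (Ici δ).indicator (fun s => g (v - s • (q.1 : E))) q.2)
    simpa only [lintegral_indicator measurableSet_Ici] using this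
  calc ∫⁻ ω, (∫⁻ s in {s : ℝ | δ ≤ |s|}, g (v - s • (ω : E))) ∂(sphereMeasure : Measure (sphere (0 : E) 1))
      = (∫⁻ ω, (∫⁻ s in Ici δ, g (v - s • (ω : E))) ∂(sphereMeasure : Measure (sphere (0 : E) 1))) +
          ∫⁻ ω, (∫⁻ s in Ici δ, g (v - s • (((-ω : sphere (0 : E) 1)) : E))) ∂(sphereMeasure : Measure (sphere (0 : E) 1)) := by
        rw [← lintegral_add_left hmeas1]
        exact lintegral_congr fun ω => hsplit ω
    _ = 2 * ∫⁻ ω, (∫⁻ s in Ici δ, g (v - s • (ω : E))) ∂(sphereMeasure : Measure (sphere (0 : E) 1)) := by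
        rw [two_mul]
        congr 1
        exact (measurePreserving_neg_sphere (E := E)).lintegral_comp hmeas1
    _ ≤ 2 * ∫⁻ ω, ENNReal.ofReal ((δ ^ (d - 1))⁻¹) *
          (∫⁻ s in Ioi (0 : ℝ), ENNReal.ofReal (s ^ (d - 1)) * g (v - s • (ω : E))) ∂(sphereMeasure : Measure (sphere (0 : E) 1)) :=
        mul_le_mul_of_nonneg_left (lintegral_mono hray) bot_le
    _ = 2 * ENNReal.ofReal ((δ ^ (d - 1))⁻¹) * ∫⁻ y, g (v - y) := by
        rw [lintegral_const_mul' _ _ ENNReal.ofReal_ne_top, mul_assoc,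
          ← lintegral_eq_lintegral_sphereMeasure_radial (F := fun y => g (v - y))
            (hg.comp (measurable_const.sub measurable_id))]
    _ = 2 * ENNReal.ofReal ((δ ^ (d - 1))⁻¹) * ∫⁻ y, g y := by rw [lintegral_sub_left_eq_self g v]

/-! ## The line bound for the gain term -/

/-- **The line bound for grazing-truncated kernels** (the mechanism of CIP 1994 (3.19), p. 146:
polar coordinates along the direction `ω`, the Jacobian `|y|^{d-1} ≥ δ^{d-1}` on the support):
for a measurable kernel `0 ≤ b ≤ M` on `E × S^{d-1}` vanishing for `|z| > R` and for
`|⟨z, ω⟩| < δ`, measurable `g ≥ 0` and every `v`,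
`∫_{S^{d-1}} ∫_E b(z, ω) g(v - ⟨z, ω⟩ ω) dz dσ(ω) ≤ 2 M (2R)^{d-1} δ^{1-d} ∫_E g`.
Here `v - ⟨z, ω⟩ω = v'` is the post-collisional velocity for the relative velocity `z = v - v_*`,
so this bounds `∫∫ B(v - v_*, ω) g(v') dv_* dω` by the `L¹` norm of `g`, linearly. [cite: CIPDiluteGases1994, §5.3 (3.19) (pp. 145–146)] -/
theorem lintegral_kernel_gain_line_le [Nontrivial E] {b : E × sphere (0 : E) 1 → ℝ≥0∞}
    {M : ℝ≥0∞} (hM : M ≠ ∞) (hbM : ∀ q, b q ≤ M) {R δ : ℝ} (hδ : 0 < δ)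
    (hbR : ∀ q, R < ‖q.1‖ → b q = 0) (hbδ : ∀ q : E × sphere (0 : E) 1, |⟪q.1, (q.2 : E)⟫_ℝ| < δ → b q = 0)
    {g : E → ℝ≥0∞} (hg : Measurable g) (v : E) :
    ∫⁻ ω, (∫⁻ z, b (z, ω) * g (v - ⟪z, (ω : E)⟫_ℝ • (ω : E))) ∂(sphereMeasure : Measure (sphere (0 : E) 1)) ≤
      M * ENNReal.ofReal (2 * R) ^ (Module.finrank ℝ E - 1) *
        (2 * ENNReal.ofReal ((δ ^ (Module.finrank ℝ E - 1))⁻¹)) * ∫⁻ y, g y := by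
  haveI := isFiniteMeasure_sphereMeasure (E := E)
  -- the slab bound in each direction, with `φ_ω(s) = 1_{δ ≤ |s|} g(v - sω)`
  have hdir : ∀ ω : sphere (0 : E) 1, ∫⁻ z, b (z, ω) * g (v - ⟪z, (ω : E)⟫_ℝ • (ω : E)) ≤
      M * ENNReal.ofReal (2 * R) ^ (Module.finrank ℝ E - 1) * ∫⁻ s in {s : ℝ | δ ≤ |s|}, g (v - s • (ω : E)) := by
    intro ω
    set φ : ℝ → ℝ≥0∞ := {s : ℝ | δ ≤ |s|}.indicator fun s => g (v - s • (ω : E)) with hφ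
    have hSm : MeasurableSet {s : ℝ | δ ≤ |s|} := measurableSet_le measurable_const (measurable_id.abs)
    have hφm : Measurable φ := (hg.comp (measurable_const.sub (measurable_id.smul measurable_const))).indicator hSm
    have hpt : ∀ z, b (z, ω) * g (v - ⟪z, (ω : E)⟫_ℝ • (ω : E)) ≤ b (z, ω) * φ ⟪z, (ω : E)⟫_ℝ := by
      intro z
      by_cases hz : δ ≤ |⟪z, (ω : E)⟫_ℝ|
      · simp only [hφ, indicator_of_mem (show ⟪z, (ω : E)⟫_ℝ ∈ {s : ℝ | δ ≤ |s|} from hz)]; exact le_rfl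
      · rw [hbδ (z, ω) (lt_of_not_ge hz), zero_mul, zero_mul]
    calc ∫⁻ z, b (z, ω) * g (v - ⟪z, (ω : E)⟫_ℝ • (ω : E)) ≤ ∫⁻ z, b (z, ω) * φ ⟪z, (ω : E)⟫_ℝ := lintegral_mono hpt
      _ ≤ M * ENNReal.ofReal (2 * R) ^ (Module.finrank ℝ E - 1) * ∫⁻ s in Icc (-R) R, φ s :=
          lintegral_mul_comp_inner_le (norm_eq_of_mem_sphere ω) (fun z => hbM _) (fun z hz => hbR (z, ω) hz) hφm
      _ ≤ M * ENNReal.ofReal (2 * R) ^ (Module.finrank ℝ E - 1) * ∫⁻ s in {s : ℝ | δ ≤ |s|}, g (v - s • (ω : E)) := by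
          refine mul_le_mul_of_nonneg_left ?_ bot_le
          calc ∫⁻ s in Icc (-R) R, φ s ≤ ∫⁻ s, φ s := setLIntegral_le_lintegral _ _
            _ = _ := lintegral_indicator hSm _
  calc ∫⁻ ω, (∫⁻ z, b (z, ω) * g (v - ⟪z, (ω : E)⟫_ℝ • (ω : E))) ∂(sphereMeasure : Measure (sphere (0 : E) 1))
      ≤ ∫⁻ ω, M * ENNReal.ofReal (2 * R) ^ (Module.finrank ℝ E - 1) *
          (∫⁻ s in {s : ℝ | δ ≤ |s|}, g (v - s • (ω : E))) ∂(sphereMeasure : Measure (sphere (0 : E) 1)) :=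
        lintegral_mono hdir
    _ = M * ENNReal.ofReal (2 * R) ^ (Module.finrank ℝ E - 1) *
          ∫⁻ ω, (∫⁻ s in {s : ℝ | δ ≤ |s|}, g (v - s • (ω : E))) ∂(sphereMeasure : Measure (sphere (0 : E) 1)) := by
        exact lintegral_const_mul' _ _ (ENNReal.mul_ne_top hM (ENNReal.pow_ne_top ENNReal.ofReal_ne_top))
    _ ≤ _ := by
        rw [mul_assoc (M * _)]
        exact mul_le_mul_of_nonneg_left (lintegral_sphere_line_le hg v hδ) bot_le

end Literature.MathematicalPhysics.KineticTheory
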